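import Summits.ABC.IUTFork.LDHLopsidedWitnessAdmissible
import HarnessLib

/-!
# The fork at [IUTchIII] Corollary 3.12, L-DH level: a LOPSIDED point family on the `λ`-line over `ℚ(i)` —
# IV. heights of `P_k = (F, λ_k)` WITHOUT factorisation: `log q^{∤S} ≥ 2k·log 5`, `log 𝔣^{∤S} ≤ log(6·125^k)`,
# the local-height budget `Σ_U ord_U(y_k) ≤ 2·log(6·125^k)/log 2`, and `log-diff = (log 4)/2`

Proof-only file (D-0012; 0 definitions, no `Prop` fact) of the abc-iut cell (seat abc-iut-w5-d126, gen 5; row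
«HABOVE-LOPSIDED-WITNESS», crux `ThetaPartII` = stmt-ABC-19678, (U) line, VERDICT RISK ¶7). TAKES NO SIDE on [IUTchIII]
Cor. 3.12 or [IUTchIV] Thm. 1.10; classical arithmetic. Sequel of `LDHLopsidedWitnessPoint` / `…Orders` / `…Admissible`
(`λ_k = a/b`, `a = π^{2k}`, `b = 2a + 1`, `c = a + 1`, `y_k = a·b·c`, `π = 2 + i`). S. Mochizuki, *IUT IV* [Mochizuki2012],
Cor. 2.2 (i) p. 41 (`log(q)`, local heights), Thm. 1.10 p. 23 (`log(𝔣)`); [MochizukiGenEll2010] §1 p. 4 (product formula),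
Def. 1.5 (iii) p. 8 (log-diff); [IrelandRosen1982] Ch. 9 §7 p. 120; Dupuy–Hilado [DupuyHilado2025] §2.4.2, §3.6.

Everything is bounded through ONE algebraic integer `y_k = a·b·c` and the product formula — no prime of `b` or `c` is ever
named (the point of the construction: (P2) will be certified by COUNTING, part V):
* **`sum_ord_mul_logNorm_le`** — `Σ_U ord_U(y_k)·log N(U) ≤ 2·log(6·125^k)` (product formula + `|φ(y_k)| ≤ 6·125^k` at both
  complex embeddings); **`sum_ord_le`** — the budget `Σ_U ord_U(y_k) ≤ 2·log(6·125^k)/log 2` (`log N(U) ≥ log 2`);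
  `mem_support_of_ord_jInv_neg` — every pole of `j(λ_k)` is in the support of `y_k`;
* **`logCondAvoid_le`** — `log 𝔣^{∤S}(λ_k) ≤ log(6·125^k)` for every `S` (bad places divide `y_k`);
* **`logQAvoid_ge`** — `2k·log 5 ≤ log q^{∤S}(λ_k)` whenever no prime of `S` lies under `V` (e.g. `S = ∅`, `S = {2, l}`,
  `l ≠ 5`): the single term of the pole `V ∋ π` (`h_V ≥ 4k`, `Pr`-normalisation `1/[F:ℚ] = 1/2`, `ln N(V) = ln 5`);
* **`logDiff_eq`** — `log-diff(P_k) = (log 4)/2` (`|disc ℚ(i)| = 4`, Mathlib `IsCyclotomicExtension.Rat.discr_prime_pow`).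
HONEST SCOPE: classical; nothing asserted about print; nothing about Cor. 3.12. [cite: MochizukiGenEll2010, §1 p.4]
[cite: MochizukiGenEll2010, Def 1.5 (iii) p.8] [cite: IrelandRosen1982, Ch. 9 §7 p. 120] [cite: DupuyHilado2025, §2.4.2, §3.6]
[claim: Mochizuki2012, status: disputed] for every IUT locator quoted.
-/

noncomputable section

namespace Summit.ABC.IUTFork

namespace LopsidedWitness

open NumberField IsDedekindDomain Metric Finset
open Literature.IUT.LogVolume Literature.IUT.LogVolume.Cor22
open Literature.NumberTheory.DiophantineGeometry Literature.NumberTheory.DiophantineGeometry.GenEll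
open Literature.NumberTheory.NumberFields
open SplitBadWitness

variable {F : Type} [Field F] [NumberField F] {ζ : 𝓞 F}

/-! ## The product formula at `y_k = a·b·c` -/

omit [NumberField F] in
/-- `y_k = a·b·c` read in the field. [cite: IrelandRosen1982, Ch. 9 §7 p. 120] -/
theorem coe_y (ζ : 𝓞 F) (k : ℕ) :
    ((((2 + ζ) ^ (2 * k) * (2 * (2 + ζ) ^ (2 * k) + 1) * ((2 + ζ) ^ (2 * k) + 1) : 𝓞 F)) : F) =
      (2 + (ζ : F)) ^ (2 * k) * (2 * (2 + (ζ : F)) ^ (2 * k) + 1) * ((2 + (ζ : F)) ^ (2 * k) + 1) := by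
  simp only [RingOfIntegers.coe_eq_algebraMap, map_add, map_mul, map_one, map_pow, map_ofNat]

/-- `y_k ≠ 0` in the field. [cite: IrelandRosen1982, Ch. 9 §7 p. 120] -/
theorem yF_ne_zero [IsCyclotomicExtension {4} ℚ F] (hζ : IsPrimitiveRoot ζ 4) {k : ℕ} (hk : 1 ≤ k) :
    ((((2 + ζ) ^ (2 * k) * (2 * (2 + ζ) ^ (2 * k) + 1) * ((2 + ζ) ^ (2 * k) + 1) : 𝓞 F)) : F) ≠ 0 := by
  rw [coe_y]
  exact mul_ne_zero (mul_ne_zero (pow_ne_zero _ (piF_ne_zero hζ)) (bF_ne_zero hζ hk)) (cF_ne_zero hζ hk)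

/-- `|φ(y_k)| ≤ 6·125^k` at every complex embedding. [cite: IrelandRosen1982, Ch. 9 §7 p. 120] -/
theorem norm_embedding_y_le (hζ : IsPrimitiveRoot ζ 4) (φ : F →+* ℂ) (k : ℕ) :
    ‖φ ((((2 + ζ) ^ (2 * k) * (2 * (2 + ζ) ^ (2 * k) + 1) * ((2 + ζ) ^ (2 * k) + 1) : 𝓞 F)) : F)‖ ≤ 6 * 125 ^ k := by
  rw [coe_y, map_mul, map_mul, norm_mul, norm_mul, norm_embedding_a hζ φ k]
  have hb := norm_embedding_b_le hζ φ k
  have hc := norm_embedding_c_le hζ φ k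
  have h5 : (0 : ℝ) ≤ 5 ^ k := by positivity
  have e : (6 : ℝ) * 125 ^ k = 5 ^ k * (3 * 5 ^ k) * (2 * 5 ^ k) := by
    rw [show (125 : ℝ) = 5 ^ 3 by norm_num, ← pow_mul]; ring
  rw [e]
  exact mul_le_mul (mul_le_mul_of_nonneg_left hb h5) hc (norm_nonneg _) (by positivity)

/-- **`Σ_U ord_U(y_k)·log N(U) ≤ 2·log(6·125^k)`** (sum over the support of `y_k`; product formula, `[F:ℚ] = 2`,
`|φ(y_k)| ≤ 6·125^k`). [cite: MochizukiGenEll2010, §1 p.4] -/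
theorem sum_ord_mul_logNorm_le [IsCyclotomicExtension {4} ℚ F] (hζ : IsPrimitiveRoot ζ 4) {k : ℕ} (hk : 1 ≤ k) :
    ∑ U ∈ (finite_setOf_ord_ne_zero F
        ((((2 + ζ) ^ (2 * k) * (2 * (2 + ζ) ^ (2 * k) + 1) * ((2 + ζ) ^ (2 * k) + 1) : 𝓞 F)) : F)).toFinset,
      (ord F U ((((2 + ζ) ^ (2 * k) * (2 * (2 + ζ) ^ (2 * k) + 1) * ((2 + ζ) ^ (2 * k) + 1) : 𝓞 F)) : F) : ℝ) *
        logNorm F U ≤ 2 * Real.log (6 * 125 ^ k) := by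
  set y : F := ((((2 + ζ) ^ (2 * k) * (2 * (2 + ζ) ^ (2 * k) + 1) * ((2 + ζ) ^ (2 * k) + 1) : 𝓞 F)) : F) with hy
  have hy0 : y ≠ 0 := yF_ne_zero hζ hk
  rw [sum_ord_mul_logNorm_eq_sum_mult_log hy0 (by simp [hy])]
  have hle : ∀ w : InfinitePlace F, (w.mult : ℝ) * Real.log (w y) ≤ (w.mult : ℝ) * Real.log (6 * 125 ^ k) := by
    intro w
    refine mul_le_mul_of_nonneg_left (Real.log_le_log (w.pos_iff.mpr hy0) ?_) (Nat.cast_nonneg _)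
    rw [← InfinitePlace.norm_embedding_eq w]
    exact norm_embedding_y_le hζ w.embedding k
  refine (Finset.sum_le_sum fun w _ => hle w).trans ?_
  rw [← Finset.sum_mul, ← Nat.cast_sum, InfinitePlace.sum_mult_eq, finrank_eq_two F]
  push_cast
  rfl

/-- `log 2 ≤ log N(U)` for every finite place. [cite: NeukirchANT1999, Ch. I §8] -/
theorem log_two_le_logNorm (U : HeightOneSpectrum (𝓞 F)) : Real.log 2 ≤ logNorm F U := by
  unfold logNorm
  have h := NumberField.HeightOneSpectrum.one_lt_absNorm U
  exact Real.log_le_log (by norm_num) (by exact_mod_cast h)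

/-- **The local-height budget: `Σ_U ord_U(y_k) ≤ 2·log(6·125^k)/log 2`.** [cite: MochizukiGenEll2010, §1 p.4] -/
theorem sum_ord_le [IsCyclotomicExtension {4} ℚ F] (hζ : IsPrimitiveRoot ζ 4) {k : ℕ} (hk : 1 ≤ k) :
    ∑ U ∈ (finite_setOf_ord_ne_zero F
        ((((2 + ζ) ^ (2 * k) * (2 * (2 + ζ) ^ (2 * k) + 1) * ((2 + ζ) ^ (2 * k) + 1) : 𝓞 F)) : F)).toFinset,
      (ord F U ((((2 + ζ) ^ (2 * k) * (2 * (2 + ζ) ^ (2 * k) + 1) * ((2 + ζ) ^ (2 * k) + 1) : 𝓞 F)) : F) : ℝ) ≤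
        2 * Real.log (6 * 125 ^ k) / Real.log 2 := by
  have hlog2 : 0 < Real.log 2 := Real.log_pos (by norm_num)
  rw [le_div_iff₀ hlog2, Finset.sum_mul]
  refine le_trans (Finset.sum_le_sum fun U _ => ?_) (sum_ord_mul_logNorm_le hζ hk)
  exact mul_le_mul_of_nonneg_left (log_two_le_logNorm U) (by exact_mod_cast ord_nonneg_of_isIntegral F U _)

/-- **Every pole of `j(λ_k)` lies in the support of `y_k`.** [cite: DupuyHilado2025, §2.4.2] -/
theorem mem_support_of_ord_jInv_neg [IsCyclotomicExtension {4} ℚ F] (hζ : IsPrimitiveRoot ζ 4) {k : ℕ} (hk : 1 ≤ k)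
    (U : HeightOneSpectrum (𝓞 F))
    (hU : ord F U (jInv ((2 + (ζ : F)) ^ (2 * k) / (2 * (2 + (ζ : F)) ^ (2 * k) + 1))) < 0) :
    U ∈ (finite_setOf_ord_ne_zero F
        ((((2 + ζ) ^ (2 * k) * (2 * (2 + ζ) ^ (2 * k) + 1) * ((2 + ζ) ^ (2 * k) + 1) : 𝓞 F)) : F)).toFinset := by
  rw [Set.Finite.mem_toFinset, Set.mem_setOf_eq]
  have := ord_y_pos_of_ord_jInv_neg hζ hk U hU
  omega

/-! ## `log 𝔣^{∤S} ≤ log(6·125^k)` and `log q^{∤S} ≥ 2k·log 5` -/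

/-- **`log 𝔣^{∤S}(λ_k) ≤ log(6·125^k)`** for every `S`: every bad place divides `y_k`, `[F:ℚ] = 2`.
[cite: Mochizuki2012, IUTchIV Thm. 1.10 p. 23] [claim: Mochizuki2012, status: disputed] -/
theorem logCondAvoid_le [IsCyclotomicExtension {4} ℚ F] (hζ : IsPrimitiveRoot ζ 4) {k : ℕ} (hk : 1 ≤ k) (S : Finset ℕ) :
    logCondAvoid (⟨F, (2 + (ζ : F)) ^ (2 * k) / (2 * (2 + (ζ : F)) ^ (2 * k) + 1)⟩ : NFPoint) S ≤
      Real.log (6 * 125 ^ k) := by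
  classical
  set Pk : NFPoint := ⟨F, (2 + (ζ : F)) ^ (2 * k) / (2 * (2 + (ζ : F)) ^ (2 * k) + 1)⟩ with hPk
  set y : F := ((((2 + ζ) ^ (2 * k) * (2 * (2 + ζ) ^ (2 * k) + 1) * ((2 + ζ) ^ (2 * k) + 1) : 𝓞 F)) : F) with hy
  set T := (finite_setOf_ord_ne_zero F y).toFinset with hT
  have hav : logCondAvoid Pk S =
      (Pk.degree : ℝ)⁻¹ * ∑ v ∈ (badPlaces Pk).filter (fun v => ∀ p ∈ S, ((p : ℕ) : 𝓞 Pk.F) ∉ v.asIdeal),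
        logNorm Pk.F v := by
    unfold logCondAvoid Cor22.condDivisor NFPoint.degree
    rw [FinDivisor.ndeg_apply, FinDivisor.deg_sum_of, div_eq_inv_mul]
    congr 1
    exact Finset.sum_congr rfl fun v _ => one_mul _
  have hd : (Pk.degree : ℝ) = 2 := by
    change ((Module.finrank ℚ F : ℕ) : ℝ) = 2; rw [finrank_eq_two F]; norm_num
  rw [hav, hd]
  -- the filtered bad places all divide `y_k`
  have hsub : (badPlaces Pk).filter (fun v => ∀ p ∈ S, ((p : ℕ) : 𝓞 Pk.F) ∉ v.asIdeal) ⊆ T := by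
    intro v hv
    have hbad := (Finset.mem_filter.mp hv).1
    exact mem_support_of_ord_jInv_neg hζ hk v ((mem_badPlaces_iff_ord_neg Pk v).1 hbad)
  have h1 : ∑ v ∈ (badPlaces Pk).filter (fun v => ∀ p ∈ S, ((p : ℕ) : 𝓞 Pk.F) ∉ v.asIdeal), logNorm Pk.F v ≤
      ∑ U ∈ T, (ord F U y : ℝ) * logNorm F U := by
    refine le_trans (Finset.sum_le_sum fun v hv => ?_)
      (Finset.sum_le_sum_of_subset_of_nonneg hsub fun U _ _ =>
        mul_nonneg (by exact_mod_cast ord_nonneg_of_isIntegral F U _) (logNorm_pos F U).le)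
    have hbad := (Finset.mem_filter.mp hv).1
    have hpos := ord_y_pos_of_ord_jInv_neg hζ hk v ((mem_badPlaces_iff_ord_neg Pk v).1 hbad)
    have h1 : (1 : ℝ) ≤ (ord F v y : ℝ) := by exact_mod_cast hpos
    change logNorm F v ≤ (ord F v y : ℝ) * logNorm F v
    nlinarith [logNorm_pos F v]
  have h2 := sum_ord_mul_logNorm_le hζ hk
  rw [← hy, ← hT] at h2
  have : (2 : ℝ)⁻¹ * ∑ v ∈ (badPlaces Pk).filter (fun v => ∀ p ∈ S, ((p : ℕ) : 𝓞 Pk.F) ∉ v.asIdeal), logNorm Pk.F v ≤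
      (2 : ℝ)⁻¹ * (2 * Real.log (6 * 125 ^ k)) := mul_le_mul_of_nonneg_left (h1.trans h2) (by norm_num)
  linarith

/-- **`2k·log 5 ≤ log q^{∤S}(λ_k)`** whenever no prime of `S` lies in `V ∋ π` (the pole `V` has `h_V = −ord_V j ≥ 4k`,
`ln N(V) = ln 5`, normalisation `1/[F:ℚ] = 1/2`). [cite: Mochizuki2012, IUTchIV Cor. 2.2 (i) p. 41] [claim: Mochizuki2012, status: disputed] -/
theorem logQAvoid_ge [IsCyclotomicExtension {4} ℚ F] (hζ : IsPrimitiveRoot ζ 4) {k : ℕ} (hk : 1 ≤ k)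
    {V : HeightOneSpectrum (𝓞 F)} (hV : (2 + ζ : 𝓞 F) ∈ V.asIdeal) (hlogV : logNorm F V = Real.log 5)
    (S : Finset ℕ) (hS : ∀ p ∈ S, ((p : ℕ) : 𝓞 F) ∉ V.asIdeal) :
    2 * k * Real.log 5 ≤ logQAvoid (⟨F, (2 + (ζ : F)) ^ (2 * k) / (2 * (2 + (ζ : F)) ^ (2 * k) + 1)⟩ : NFPoint) S := by
  classical
  set Pk : NFPoint := ⟨F, (2 + (ζ : F)) ^ (2 * k) / (2 * (2 + (ζ : F)) ^ (2 * k) + 1)⟩ with hPk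
  have hdeg := degree_mul_logQAvoid Pk S
  have hd : (Pk.degree : ℝ) = 2 := by
    change ((Module.finrank ℚ F : ℕ) : ℝ) = 2; rw [finrank_eq_two F]; norm_num
  rw [hd] at hdeg
  have hVmem : V ∈ (badPlaces Pk).filter (fun v => ∀ p ∈ S, ((p : ℕ) : 𝓞 Pk.F) ∉ v.asIdeal) :=
    Finset.mem_filter.mpr ⟨mem_badPlaces_V hζ hV hk, hS⟩
  have hsingle : localHeight Pk V * logNorm F V ≤
      ∑ v ∈ (badPlaces Pk).filter (fun v => ∀ p ∈ S, ((p : ℕ) : 𝓞 Pk.F) ∉ v.asIdeal), localHeight Pk v * logNorm Pk.F v :=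
    Finset.single_le_sum (fun v _ => mul_nonneg (localHeight_nonneg Pk v) (logNorm_pos Pk.F v).le) hVmem
  have hloc : (4 * k : ℝ) ≤ localHeight Pk V := by
    have hle := ord_jInv_V_le hζ hV hk
    unfold localHeight
    change (4 * k : ℝ) ≤ (((-(ord F V (jInv ((2 + (ζ : F)) ^ (2 * k) / (2 * (2 + (ζ : F)) ^ (2 * k) + 1))))).toNat : ℕ) : ℝ)
    have h1 : (4 * k : ℤ) ≤ (-(ord F V (jInv ((2 + (ζ : F)) ^ (2 * k) / (2 * (2 + (ζ : F)) ^ (2 * k) + 1))))).toNat := by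
      rw [Int.toNat_of_nonneg (by push_cast at hle; omega)]
      push_cast at hle ⊢; omega
    exact_mod_cast h1
  have hlog5 : 0 < Real.log 5 := Real.log_pos (by norm_num)
  rw [hlogV] at hsingle
  nlinarith

/-! ## The log-different of `ℚ(i)` -/

/-- **`log-diff(P_k) = (log 4)/2`**: `|disc ℚ(i)| = 4`, `[ℚ(i):ℚ] = 2`. [cite: MochizukiGenEll2010, Def 1.5 (iii) p.8] -/
theorem logDiff_eq [IsCyclotomicExtension {4} ℚ F] (x : F) : (NFPoint.mk F x).logDiff = Real.log 4 / 2 := by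
  haveI : Fact (Nat.Prime 2) := ⟨Nat.prime_two⟩
  haveI h4 : IsCyclotomicExtension {2 ^ 2} ℚ F := by norm_num; infer_instance
  rw [NFPoint.logDiff_eq_log_discr]
  have hd : NumberField.discr F = (-1) ^ ((2 ^ 2).totient / 2) * (2 : ℕ) ^ (2 ^ (2 - 1) * ((2 - 1) * 2 - 1)) :=
    IsCyclotomicExtension.Rat.discr_prime_pow 2 2 F
  have hdeg : (NFPoint.mk F x).degree = 2 := by
    show Module.finrank ℚ F = 2
    exact finrank_eq_two F
  rw [hdeg]
  show (((2 : ℕ) : ℝ))⁻¹ * Real.log ((NumberField.discr F).natAbs : ℝ) = _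
  rw [hd]
  have ht : (2 ^ 2 : ℕ).totient / 2 = 1 := by decide
  rw [ht]
  norm_num
  ring

end LopsidedWitness

end Summit.ABC.IUTFork

end
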